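import Literature.NumberTheory.QuadraticFields.QuadraticIrrationalDuplication
import Literature.Computability.Cryptography.HallgrenClassGroupComposition
import Mathlib.Algebra.QuadraticAlgebra.Basic
import HarnessLib

/-!
# The product of two ideal-shaped quadratic irrationals' lattices: Gauss composition, general case

Topic `Computability/Cryptography`; the arithmetic of the GENERAL giant step `I · J` of Hallgren's
walk (`InfrastructureNavigation.WalkData.giantStep`: the descent multiplies the accumulated ideal by
the stored powers `I_k`, Jozsa 2003 §9 proof of Thm. 5, so products of two DISTINCT reduced
principal ideals are needed, not only squares). Theorem-and-definition file, no named facts.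

`QuadraticFields/QuadraticIrrationalDuplication.lean` treats the square `I · I` by explicit
generator bookkeeping; here the general product is obtained by TRANSPORT from the tree's ideal-level
composition in an abstract quadratic ring (`HallgrenClassGroupComposition.lean`,
`Composition.mul_eq_span_singleton_mul`: `(a₁, ω − k₁)(a₂, ω − k₂) = (d)(A, ω − k₃)` in any
commutative ring with `ℤ`-basis `(1, ω)`, `ω² = m + tω`, via the Hermite form of the product
lattice — Jozsa's Prop. 34 is the same statement with explicit Bézout data). The ring is Mathlib's
`QuadraticAlgebra ℤ (mD D) D` (`ω² = (D − D²)/4 + Dω`, i.e. `ω = (D + √D)/2`, the convention of the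
class-group files), embedded in `ℝ` by `QuadraticAlgebra.lift` at `(D + √D)/2`:

* `mD`, `QA D`, its basis `qb` (`qb 0 = 1`, `qb 1 = ω`, `qb_rel`), the embedding `emb hD4`
  (`emb_mk`, `emb_omega_sub`);
* the dictionary `fa x = Q/2`, `kq x = (D − P)/2` (so that `ω − kq x ↦ (P + √D)/2`; `kq` is the
  class-group files' `kOf D (a, −P, c)`), the norm condition `fa_mul_fc` (`a c = k² − Dk − m`);
* the transport lemmas `two_mul_emb_mem_latZ` / `exists_of_mem_latZ` (`L(x) = 2 · emb (a, ω − k(x))`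
  elementwise, by `FormIdeals.mem_span_pair_iff_of_basis`);
* **`comp x y`** — the composed quotient `(D − 2k₃, 2A)` — with `comp_Q_pos`, `isIdealShaped_comp`,
  and **`latZ_mul_latZ_comp`**:
  `L(x) · L(y) = ℤ(2d·Q₃) + ℤ(2d·(P₃ + √D)) = 2d · L(comp x y)` (`d = compScalar x y > 0`),
  the general case of `QuadIrr.latZ_mul_latZ`.

## References

* R. Jozsa, *Notes on Hallgren's efficient quantum algorithm for solving Pell's equation*,
  arXiv:quant-ph/0302134 (2003), §7.1 Prop. 34 (`I₃ = I₁ · I₂`), §9 (proof of Thm. 5). [Jozsa2003]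
* D. A. Cox, *Primes of the form x² + ny²*, 2nd ed. (2013), §7.B Thm. 7.7, §3.A. [Cox2013]
* D. A. Buell, *Binary Quadratic Forms*, Springer (1989), §4.2 (composition algorithms). [Buell1989]
-/

noncomputable section

open scoped Classical Pointwise QuadraticAlgebra

namespace Literature.Computability.Cryptography

namespace HallgrenComposition

open Literature.NumberTheory.QuadraticFields Literature.NumberTheory.QuadraticFields.QuadIrr
  Hallgren2005.Composition Module

variable {D : ℕ}

/-! ### The order `ℤ[(D + √D)/2]` as a `QuadraticAlgebra`, embedded in `ℝ` -/

/-- `m(D) = (D − D²)/4`, so that `ω = (D + √D)/2` satisfies `ω² = m(D) + Dω` (the class-group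
files' `FormComposition.mOf D`, restated to keep imports light). [cite: Cox2013, §7.A (orders ℤ[fω_K])] -/
def mD (D : ℕ) : ℤ := ((D : ℤ) - (D : ℤ) ^ 2) / 4

/-- `4 m(D) = D − D²` for a discriminant `D ≡ 0, 1 (mod 4)`. [folklore] -/
theorem four_mul_mD (hD4 : D % 4 = 0 ∨ D % 4 = 1) : 4 * mD D = (D : ℤ) - (D : ℤ) ^ 2 := by
  unfold mD
  have h : (4 : ℤ) ∣ (D : ℤ) - (D : ℤ) ^ 2 := by
    have hD := Nat.div_add_mod D 4
    rcases hD4 with h0 | h1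
    · refine ⟨((D / 4 : ℕ) : ℤ) - 4 * ((D / 4 : ℕ) : ℤ) ^ 2, ?_⟩
      have : (D : ℤ) = 4 * ((D / 4 : ℕ) : ℤ) := by omega
      rw [this]; ring
    · refine ⟨-(4 * ((D / 4 : ℕ) : ℤ) ^ 2 + ((D / 4 : ℕ) : ℤ)), ?_⟩
      have : (D : ℤ) = 4 * ((D / 4 : ℕ) : ℤ) + 1 := by omega
      rw [this]; ring
  exact Int.mul_ediv_cancel' h

/-- **The quadratic order `ℤ[ω]`, `ω² = m(D) + Dω`.** [cite: Cox2013, §7.A] -/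
abbrev QA (D : ℕ) : Type := QuadraticAlgebra ℤ (mD D) (D : ℤ)

/-- Its `ℤ`-basis `(1, ω)`. [folklore] -/
abbrev qb (D : ℕ) : Basis (Fin 2) ℤ (QA D) := QuadraticAlgebra.basis (mD D) (D : ℤ)

/-- `qb 0 = 1`. [folklore] -/
theorem qb_zero : qb D 0 = 1 := by
  rw [qb, QuadraticAlgebra.basis, Basis.coe_ofEquivFun]
  ext <;> simp

/-- `qb 1 = ω`. [folklore] -/
theorem qb_one : qb D 1 = ω := by
  rw [qb, QuadraticAlgebra.basis, Basis.coe_ofEquivFun]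
  ext <;> simp [QuadraticAlgebra.omega]

/-- `ω² = m(D) + Dω` in the form used by `Composition` (§Ring). [folklore] -/
theorem qb_rel : qb D 1 * qb D 1 = (mD D : QA D) + ((D : ℤ) : QA D) * qb D 1 := by
  rw [qb_one]; ext <;> simp [QuadraticAlgebra.omega]

/-- The real root `(D + √D)/2` of `u² = m(D) + Du`. [cite: Cox2013, §7.A (ω = (d_K + √d_K)/2)] -/
def rootR (D : ℕ) : ℝ := ((D : ℝ) + Real.sqrt D) / 2

/-- `rootR² = m(D) + D·rootR` for `D ≡ 0, 1 (mod 4)`. [folklore] -/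
theorem rootR_mul_rootR (hD4 : D % 4 = 0 ∨ D % 4 = 1) :
    rootR D * rootR D = (mD D : ℤ) • (1 : ℝ) + ((D : ℤ) : ℤ) • rootR D := by
  have h4 : (4 : ℝ) * (mD D : ℝ) = (D : ℝ) - (D : ℝ) ^ 2 := by exact_mod_cast four_mul_mD hD4
  have hs : Real.sqrt (D : ℝ) ^ 2 = D := Real.sq_sqrt (Nat.cast_nonneg _)
  simp only [zsmul_eq_mul, Int.cast_natCast, mul_one]
  unfold rootR
  nlinarith [hs, h4]

/-- **The embedding `ℤ[ω] → ℝ`, `ω ↦ (D + √D)/2`.** [cite: Cox2013, §7.A] -/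
def emb (hD4 : D % 4 = 0 ∨ D % 4 = 1) : QA D →ₐ[ℤ] ℝ :=
  QuadraticAlgebra.lift ⟨rootR D, rootR_mul_rootR hD4⟩

/-- `emb ⟨u, v⟩ = u + v (D + √D)/2`. [folklore] -/
theorem emb_mk (hD4 : D % 4 = 0 ∨ D % 4 = 1) (u v : ℤ) :
    emb hD4 (⟨u, v⟩ : QA D) = (u : ℝ) + (v : ℝ) * rootR D := by
  simp [emb, QuadraticAlgebra.lift, zsmul_eq_mul]

/-- `emb n = n` on integers. [folklore] -/
theorem emb_intCast (hD4 : D % 4 = 0 ∨ D % 4 = 1) (n : ℤ) : emb hD4 (n : QA D) = n := by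
  rw [show (n : QA D) = ⟨n, 0⟩ from rfl, emb_mk]; simp

/-- `emb (ω − k) = ((D − 2k) + √D)/2`. [folklore] -/
theorem emb_omega_sub (hD4 : D % 4 = 0 ∨ D % 4 = 1) (k : ℤ) :
    emb hD4 ((ω : QA D) - (k : QA D)) = (((D : ℤ) - 2 * k : ℤ) + Real.sqrt D) / 2 := by
  rw [map_sub, emb_intCast, show (ω : QA D) = ⟨0, 1⟩ from rfl, emb_mk]
  unfold rootR; push_cast; ring

/-! ### The dictionary between quotients `(P, Q)` and form ideals `(a, ω − k)` -/

/-- `k(x) = (D − P)/2`: the ideal `aℤ + ((P + √D)/2)ℤ` of `x = (P, 2a)` is `(a, ω − k(x))`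
(`= kOf D (a, −P, c)` of the class-group files). [cite: Cox2013, §7.B Thm. 7.7 ([a, (−b + √D)/2])] -/
def kq (x : QuadIrr D) : ℤ := (-x.P + (D : ℤ)) / 2

/-- For ideal-shaped `x` and `D ≡ 0, 1 (mod 4)`, `P ≡ D (mod 2)`, so `2 k(x) = D − P`. [folklore] -/
theorem two_mul_kq (hD4 : D % 4 = 0 ∨ D % 4 = 1) {x : QuadIrr D} (h : x.IsIdealShaped) :
    2 * kq x = (D : ℤ) - x.P := by
  have h4 : (4 : ℤ) ∣ x.P ^ 2 - D := ⟨fa x * fc x, by rw [sq_sub_eq h]; ring⟩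
  have hpar : ∃ s : ℤ, (x.P ^ 2 = 4 * s ∧ x.P % 2 = 0) ∨ (x.P ^ 2 = 4 * s + 1 ∧ x.P % 2 = 1) := by
    rcases Int.even_or_odd' x.P with ⟨r, hr | hr⟩
    · exact ⟨r * r, Or.inl ⟨by rw [hr]; ring, by omega⟩⟩
    · exact ⟨r * r + r, Or.inr ⟨by rw [hr]; ring, by omega⟩⟩
  obtain ⟨s, hs⟩ := hpar
  obtain ⟨c, hc⟩ := h4
  generalize hP2 : x.P ^ 2 = P2 at hs hc
  have h2 : (2 : ℤ) ∣ -x.P + D := by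
    rcases hs with ⟨h1, h1'⟩ | ⟨h1, h1'⟩ <;> rcases hD4 with hd | hd <;> omega
  unfold kq
  rw [Int.mul_ediv_cancel' h2]; ring

/-- **The norm condition** `a · c = k² − Dk − m(D)` for `x = (P, 2a)` ideal-shaped (so that
`(a, ω − k)` is a lattice ideal, `FormIdeals.mem_span_pair_iff_of_basis`). [cite: Cox2013, §7.A (7.9)] -/
theorem fa_mul_fc (hD4 : D % 4 = 0 ∨ D % 4 = 1) {x : QuadIrr D} (h : x.IsIdealShaped) :
    fa x * fc x = kq x ^ 2 - (D : ℤ) * kq x - mD D := by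
  have h1 := sq_sub_eq h          -- P² − D = 4 a c
  have h2 := two_mul_kq hD4 h     -- 2k = D − P
  have h3 := four_mul_mD hD4      -- 4m = D − D²
  have h4 : 4 * (fa x * fc x) = 4 * (kq x ^ 2 - (D : ℤ) * kq x - mD D) := by
    linear_combination (-1 : ℤ) * h1 + (-2 * kq x + (D : ℤ) + x.P) * h2 + h3
  exact mul_left_cancel₀ (by norm_num : (4 : ℤ) ≠ 0) h4

/-! ### Transport lemmas -/

/-- The form ideal `(a, ω − k(x))` of `x` in `ℤ[ω]`. [cite: Cox2013, §7.B Thm. 7.7] -/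
def idl (x : QuadIrr D) : Ideal (QA D) := Ideal.span {((fa x : ℤ) : QA D), ω - ((kq x : ℤ) : QA D)}

/-- `2 · emb (u a + v (ω − k)) = u (2a) + v ((D − 2k) + √D)`. [folklore] -/
theorem two_mul_emb_combo (hD4 : D % 4 = 0 ∨ D % 4 = 1) (u v a k : ℤ) :
    2 * emb hD4 ((u : QA D) * (a : QA D) + (v : QA D) * (ω - (k : QA D))) =
      (u : ℝ) * (2 * a) + (v : ℝ) * ((((D : ℤ) - 2 * k : ℤ) : ℝ) + Real.sqrt D) := by
  rw [map_add, map_mul, map_mul, emb_intCast, emb_intCast, emb_intCast, emb_omega_sub]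
  ring

/-- Elements of the form ideal map into `L(x)`: `2 · emb w ∈ L(x)` for `w ∈ (a, ω − k(x))`.
[cite: Jozsa2003, §5 Prop. 16] -/
theorem two_mul_emb_mem_latZ (hD4 : D % 4 = 0 ∨ D % 4 = 1) {x : QuadIrr D} (hx : x.IsIdealShaped)
    {w : QA D} (hw : w ∈ idl x) : 2 * emb hD4 w ∈ latZ x := by
  unfold idl at hw
  rw [← qb_one] at hw
  obtain ⟨u, v, rfl⟩ := (Quadratic.mem_span_pair_iff_of_basis (qb D) qb_zero qb_rel (fa_mul_fc hD4 hx) w).mp hw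
  rw [qb_one, two_mul_emb_combo hD4, mem_latZ_iff]
  refine ⟨u, v, ?_⟩
  have hQ : (x.Q : ℝ) = 2 * (fa x : ℝ) := by exact_mod_cast Q_eq_two_mul_fa hx
  have hk : ((((D : ℤ) - 2 * kq x : ℤ) : ℝ)) = x.P := by
    have h := two_mul_kq hD4 hx
    have : (((D : ℤ) - 2 * kq x : ℤ)) = x.P := by linarith
    exact_mod_cast this
  rw [hQ, hk]

/-- Conversely every element of `L(x)` is `2 · emb w` with `w ∈ (a, ω − k(x))`. [cite: Jozsa2003, §5 Prop. 16] -/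
theorem exists_of_mem_latZ (hD4 : D % 4 = 0 ∨ D % 4 = 1) {x : QuadIrr D} (hx : x.IsIdealShaped)
    {s : ℝ} (hs : s ∈ latZ x) : ∃ w ∈ idl x, s = 2 * emb hD4 w := by
  obtain ⟨u, v, rfl⟩ := mem_latZ_iff.mp hs
  refine ⟨(u : QA D) * ((fa x : ℤ) : QA D) + (v : QA D) * (ω - ((kq x : ℤ) : QA D)), ?_, ?_⟩
  · exact Ideal.add_mem _ (Ideal.mul_mem_left _ _ (Ideal.subset_span (by simp)))
      (Ideal.mul_mem_left _ _ (Ideal.subset_span (by simp)))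
  · rw [two_mul_emb_combo hD4]
    have hQ : (x.Q : ℝ) = 2 * (fa x : ℝ) := by exact_mod_cast Q_eq_two_mul_fa hx
    have hk : ((((D : ℤ) - 2 * kq x : ℤ) : ℝ)) = x.P := by
      have h := two_mul_kq hD4 hx
      have : (((D : ℤ) - 2 * kq x : ℤ)) = x.P := by linarith
      exact_mod_cast this
    rw [hQ, hk]

/-! ### The composed quotient -/

/-- The scalar `d = compD` of the composition of `x` and `y`. [cite: Jozsa2003, §7.1 Prop. 34 (k')] -/
def compScalar (x y : QuadIrr D) : ℤ := compD (D : ℤ) (mD D) (fa x) (kq x) (fa y) (kq y)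

/-- The first coefficient `A = compA` of the composition. [cite: Jozsa2003, §7.1 Prop. 34 (a₃)] -/
def compA' (x y : QuadIrr D) : ℤ := compA (D : ℤ) (mD D) (fa x) (kq x) (fa y) (kq y)

/-- The `k₃ = compK` of the composition. [cite: Jozsa2003, §7.1 Prop. 34 (b₃)] -/
def compK' (x y : QuadIrr D) : ℤ := compK (D : ℤ) (mD D) (fa x) (kq x) (fa y) (kq y)

/-- **The composed quotient** `comp x y = (D − 2k₃, 2A)`: its lattice `L = 2Aℤ + (P₃ + √D)ℤ` is
twice the composed ideal `(A, ω − k₃)`. [cite: Jozsa2003, §7.1 Prop. 34 (I₃ = I₁·I₂)] -/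
def comp (x y : QuadIrr D) : QuadIrr D := ⟨(D : ℤ) - 2 * compK' x y, 2 * compA' x y⟩

/-- `Q(comp x y) = 2A > 0`. [cite: Cox2013, §3.A (A > 0)] -/
theorem comp_Q_pos (hD4 : D % 4 = 0 ∨ D % 4 = 1) {x y : QuadIrr D} (hx : x.IsIdealShaped)
    (hy : y.IsIdealShaped) : 0 < (comp x y).Q := by
  have hax : fa x ≠ 0 := by have := Q_eq_two_mul_fa hx; have := hx.1; omega
  have hay : fa y ≠ 0 := by have := Q_eq_two_mul_fa hy; have := hy.1; omega
  have := compA_pos (qb D) qb_zero qb_rel hax hay (fa_mul_fc hD4 hx) (fa_mul_fc hD4 hy)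
  show 0 < 2 * compA' x y
  unfold compA'; omega

/-- The scalar `d` is positive. [folklore] -/
theorem compScalar_pos {x y : QuadIrr D} (hx : x.IsIdealShaped) : 0 < compScalar x y := by
  have hax : fa x ≠ 0 := by have := Q_eq_two_mul_fa hx; have := hx.1; omega
  exact compD_pos hax

/-- **`comp x y` is ideal-shaped**: `Q₃ = 2A > 0` is even and `2Q₃ ∣ P₃² − D`
(`P₃² − D = 4(k₃² − Dk₃ − m) = 4AC₃`). [cite: Cox2013, §3.A (the composite is a form of discriminant D)] -/
theorem isIdealShaped_comp (hD4 : D % 4 = 0 ∨ D % 4 = 1) {x y : QuadIrr D} (hx : x.IsIdealShaped)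
    (hy : y.IsIdealShaped) : (comp x y).IsIdealShaped := by
  have hax : fa x ≠ 0 := by have := Q_eq_two_mul_fa hx; have := hx.1; omega
  obtain ⟨C, hC⟩ := compA_dvd (qb D) qb_zero qb_rel hax (fa_mul_fc hD4 hx) (fa_mul_fc hD4 hy)
  refine ⟨comp_Q_pos hD4 hx hy, ⟨compA' x y, rfl⟩, ⟨C, ?_⟩⟩
  have h3 := four_mul_mD hD4
  show ((D : ℤ) - 2 * compK' x y) ^ 2 - D = 2 * (2 * compA' x y) * C
  unfold compK' compA' at *
  linear_combination (4 : ℤ) * hC + h3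

/-- The composed quotient is admissible. [folklore] -/
theorem isAdmissible_comp (hD4 : D % 4 = 0 ∨ D % 4 = 1) {x y : QuadIrr D} (hx : x.IsIdealShaped)
    (hy : y.IsIdealShaped) : (comp x y).IsAdmissible :=
  (isIdealShaped_comp hD4 hx hy).isAdmissible

/-! ### The product identity -/

/-- **Gauss composition of the lattices of two ideal-shaped quotients** (general case of
`QuadIrr.latZ_mul_latZ`): `L(x) · L(y) = ℤ(2d Q₃) + ℤ(2d (P₃ + √D)) = 2d · L(comp x y)` with
`d = compScalar x y`. Transport of `(a₁, ω − k₁)(a₂, ω − k₂) = (d)(A, ω − k₃)` along `ℤ[ω] → ℝ`,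
elementwise (`4 · emb (w₁ w₂) = (2 emb w₁)(2 emb w₂)`).
[cite: Jozsa2003, §7.1 Prop. 34 (I₃ = I₁ · I₂ with the scalar k')] [cite: Cox2013, §7.B Thm. 7.7, §3.A] -/
theorem latZ_mul_latZ_comp (hD4 : D % 4 = 0 ∨ D % 4 = 1) {x y : QuadIrr D} (hx : x.IsIdealShaped)
    (hy : y.IsIdealShaped) :
    latZ x * latZ y =
      Submodule.span ℤ {(2 * compScalar x y * (comp x y).Q : ℝ),
        2 * compScalar x y * (((comp x y).P : ℝ) + Real.sqrt D)} := by
  have hax : fa x ≠ 0 := by have := Q_eq_two_mul_fa hx; have := hx.1; omega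
  -- the ideal identity in `ℤ[ω]`
  have key : idl x * idl y = Ideal.span {((compScalar x y : ℤ) : QA D)} *
      Ideal.span {((compA' x y : ℤ) : QA D), ω - ((compK' x y : ℤ) : QA D)} := by
    have := mul_eq_span_singleton_mul (qb D) qb_zero qb_rel hax (fa_mul_fc hD4 hx) (fa_mul_fc hD4 hy)
    rw [qb_one] at this
    exact this
  obtain ⟨C, hC⟩ := compA_dvd (qb D) qb_zero qb_rel hax (fa_mul_fc hD4 hx) (fa_mul_fc hD4 hy)
  have hn3 : compA' x y * C = compK' x y ^ 2 - (D : ℤ) * compK' x y - mD D := hC.symm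
  -- the generators of the right-hand side, as `4 · emb` of elements of `(d)(A, ω − k₃)`
  have hgen : ∀ u v : ℤ, 4 * emb hD4 (((compScalar x y : ℤ) : QA D) *
      ((u : QA D) * ((compA' x y : ℤ) : QA D) + (v : QA D) * (ω - ((compK' x y : ℤ) : QA D)))) =
      (u : ℝ) * (2 * compScalar x y * (comp x y).Q) +
        (v : ℝ) * (2 * compScalar x y * (((comp x y).P : ℝ) + Real.sqrt D)) := by
    intro u v
    rw [map_mul, emb_intCast, show (4 : ℝ) * ((compScalar x y : ℤ) * emb hD4 _) =
      2 * (compScalar x y : ℝ) * (2 * emb hD4 ((u : QA D) * ((compA' x y : ℤ) : QA D) +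
        (v : QA D) * (ω - ((compK' x y : ℤ) : QA D)))) by ring, two_mul_emb_combo hD4]
    unfold comp; push_cast; ring
  apply le_antisymm
  · -- `⊆`: products of generators
    rw [Submodule.mul_le]
    intro s hs t ht
    obtain ⟨w₁, hw₁, rfl⟩ := exists_of_mem_latZ hD4 hx hs
    obtain ⟨w₂, hw₂, rfl⟩ := exists_of_mem_latZ hD4 hy ht
    have hmem : w₁ * w₂ ∈ idl x * idl y := Ideal.mul_mem_mul hw₁ hw₂
    rw [key, Ideal.mem_span_singleton_mul] at hmem
    obtain ⟨w, hw, hww⟩ := hmem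
    rw [← qb_one] at hw
    obtain ⟨u, v, rfl⟩ := (Quadratic.mem_span_pair_iff_of_basis (qb D) qb_zero qb_rel hn3 w).mp hw
    rw [qb_one] at hww
    have : 2 * emb hD4 w₁ * (2 * emb hD4 w₂) = 4 * emb hD4 (w₁ * w₂) := by rw [map_mul]; ring
    rw [this, ← hww, hgen u v, Submodule.mem_span_pair]
    exact ⟨u, v, by simp only [zsmul_eq_mul]⟩
  · -- `⊇`: the two generators are finite sums of products
    rw [Submodule.span_le]
    have hC : ∀ z ∈ idl x * idl y, 4 * emb hD4 z ∈ latZ x * latZ y := by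
      intro z hz
      refine Submodule.mul_induction_on hz ?_ ?_
      · intro r hr s' hs'
        have : 4 * emb hD4 (r * s') = (2 * emb hD4 r) * (2 * emb hD4 s') := by rw [map_mul]; ring
        rw [this]
        exact Submodule.mul_mem_mul (two_mul_emb_mem_latZ hD4 hx hr) (two_mul_emb_mem_latZ hD4 hy hs')
      · intro r s' hr hs'
        rw [map_add, mul_add]
        exact Submodule.add_mem _ hr hs'
    have hmem : ∀ u v : ℤ, ((compScalar x y : ℤ) : QA D) *
        ((u : QA D) * ((compA' x y : ℤ) : QA D) + (v : QA D) * (ω - ((compK' x y : ℤ) : QA D))) ∈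
        idl x * idl y := by
      intro u v
      rw [key]
      exact Ideal.mul_mem_mul (Ideal.mem_span_singleton_self _)
        (Ideal.add_mem _ (Ideal.mul_mem_left _ _ (Ideal.subset_span (by simp)))
          (Ideal.mul_mem_left _ _ (Ideal.subset_span (by simp))))
    intro g hg
    simp only [Set.mem_insert_iff, Set.mem_singleton_iff] at hg
    rcases hg with rfl | rfl
    · have := hC _ (hmem 1 0)
      rw [hgen 1 0] at this
      simpa using this
    · have := hC _ (hmem 0 1)
      rw [hgen 0 1] at this
      simpa using this

/-- Products of elements of `L(x)` and `L(y)` lie in `2d · L(comp x y)`. [cite: Jozsa2003, §7.1 Prop. 34] -/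
theorem mul_mem_span_comp (hD4 : D % 4 = 0 ∨ D % 4 = 1) {x y : QuadIrr D} (hx : x.IsIdealShaped)
    (hy : y.IsIdealShaped) {s t : ℝ} (hs : s ∈ latZ x) (ht : t ∈ latZ y) :
    ∃ m n : ℤ, s * t = 2 * compScalar x y * (m * (comp x y).Q + n * (((comp x y).P : ℝ) + Real.sqrt D)) := by
  have h := Submodule.mul_mem_mul hs ht
  rw [latZ_mul_latZ_comp hD4 hx hy, Submodule.mem_span_pair] at h
  obtain ⟨m, n, h⟩ := h
  refine ⟨m, n, ?_⟩
  rw [← h]; simp only [zsmul_eq_mul]; ring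

end HallgrenComposition

end Literature.Computability.Cryptography

end
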